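import Literature.Combinatorics.SimpleGraph.RamseySupersaturation
import HarnessLib

/-!
# Containers for `F`-free graphs (Nenadov–Steger Thm. 5) from the container theorem — proved

The "second tool" of Nenadov–Steger's proof of the 1-statement (CPC 2016, Thm. 5, taken there
from Saxton–Thomason): for a graph `F` (here on `Fin k`, `k ≥ 3`, without isolated vertices,
`m₂(F) > 1`) and `ε > 0`, for all large `n` there are fingerprint/container maps such that every
`F`-free graph `G` on `n` vertices has a bounded number of fingerprints `T_i ⊆ E(G)` of size
`≤ C(n,2)/n^{1/m₂(F)} ≤ n^{2 - 1/m₂(F)}` whose container `C(T) ⊇ E(G)` carries fewer than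
`ε |H_n(F)|` copies of `F` (`ns_theorem5`). Obtained here from the Bernshteyn–Delcourt–Towsner–
Tserunyan container theorem (`Literature/Combinatorics/Hypergraph/Containers.lean`) by
(i) homogeneous sparsification of the copy hypergraph on each qualifying ground set
(`copy_sparse`, from `exists_subfamily_hdeg_lt` and the co-degree bound `hdeg_copyH_le_rpow`,
which is where `m₂(F)` enters), (ii) the size lower bound for qualifying ground sets
(`copy_large`), and (iii) the iteration `iterated_containers`. The largeness of `n` is kept as
the explicit numeric hypotheses `L0`–`L5` (discharged asymptotically where the random Ramsey
theorem is assembled). Constants: `etaC k e_F ε = min (2^{-2e_F}) (ε/(12 k^k k! 2^k))`,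
`gammaC k ε = ε/(2^k k! k^k)`. Everything is a theorem; no named facts.

## References

* R. Nenadov, A. Steger, CPC 25 (2016), Thm. 5 (p. 3). [NenadovSteger2014]
* J. Balogh, R. Morris, W. Samotij, Proc. ICM 2018, §3. [BaloghMorrisSamotij2019]
-/

namespace Literature.Combinatorics.SimpleGraph

open Finset Literature.Combinatorics.Hypergraph
open _root_.SimpleGraph

/-! ## Containers for `F`-free graphs (Nenadov–Steger Thm. 5) from BDTT + sparsification -/

section CopyContainers

open Real

variable {k : ℕ} {F : _root_.SimpleGraph (Fin k)} [DecidableRel F.Adj]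

/-- The BDTT parameter `η` for the copy hypergraph: `min (2^{-2e_F}) (ε / (12 k^k k! 2^k))`.
[folklore] -/
noncomputable def etaC (k eF : ℕ) (ε : ℝ) : ℝ :=
  min (2⁻¹ ^ (2 * eF)) (ε / (12 * (k : ℝ) ^ k * k.factorial * 2 ^ k))

/-- The size fraction `γ = ε / (2^k k! k^k)` of qualifying ground sets. [folklore] -/
noncomputable def gammaC (k : ℕ) (ε : ℝ) : ℝ := ε / (2 ^ k * k.factorial * (k : ℝ) ^ k)

/-- `η > 0` (for `k ≥ 1`). [folklore] -/
theorem etaC_pos {k : ℕ} (hk : 1 ≤ k) (eF : ℕ) {ε : ℝ} (hε : 0 < ε) : 0 < etaC k eF ε := by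
  have : (0 : ℝ) < k := by exact_mod_cast hk
  unfold etaC; positivity

/-- `η ≤ 2^{-2e_F}`. [folklore] -/
theorem etaC_le_pow (k eF : ℕ) (ε : ℝ) : etaC k eF ε ≤ 2⁻¹ ^ (2 * eF) := min_le_left _ _

/-- `η ≤ ε/(12 k^k k! 2^k)`. [folklore] -/
theorem etaC_le_div (k eF : ℕ) (ε : ℝ) :
    etaC k eF ε ≤ ε / (12 * (k : ℝ) ^ k * k.factorial * 2 ^ k) := min_le_right _ _

/-- `γ > 0` (for `k ≥ 1`). [folklore] -/
theorem gammaC_pos {k : ℕ} (hk : 1 ≤ k) {ε : ℝ} (hε : 0 < ε) : 0 < gammaC k ε := by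
  have : (0 : ℝ) < k := by exact_mod_cast hk
  unfold gammaC; positivity

/-- `d₂(F) ≤ m₂(F)` for the whole vertex set: `(e_F - 1)/(k - 2) ≤ m₂(F)` when `k ≥ 3`, hence
`(e_F - 1)/m₂(F) ≤ k - 2` when `m₂(F) > 0`. [folklore] -/
theorem sub_one_div_m2Density_le (hk : 3 ≤ k) (hm : 0 < m2Density F) :
    ((#F.edgeFinset : ℝ) - 1) / (m2Density F : ℝ) ≤ (k : ℝ) - 2 := by
  have h := d2Density_le_m2Density F (U := (univ : Finset (Fin k)))
    (by rwa [card_univ, Fintype.card_fin])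
  rw [d2Density, card_univ, Fintype.card_fin] at h
  have hE : induceEdgeCard F univ = #F.edgeFinset := by
    rw [induceEdgeCard]
    congr 1
    ext e
    simp only [mem_filter, mem_edgeFinset, and_iff_right_iff_imp]
    intro _
    rw [mem_sym2_iff]
    exact fun _ _ => mem_univ _
  rw [hE] at h
  have hk' : (0 : ℚ) < (k : ℚ) - 2 := by
    have : (3 : ℚ) ≤ k := by exact_mod_cast hk
    linarith
  rw [div_le_iff₀ hk'] at h
  have hmR : (0 : ℝ) < m2Density F := by exact_mod_cast hm
  rw [div_le_iff₀ hmR]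
  have := (Rat.cast_le (K := ℝ)).2 h
  push_cast at this
  linarith

/-- A graph without isolated vertices on `k ≥ 1` vertices has an edge. [folklore] -/
theorem edgeFinset_nonempty_of_noIsolated (hF : ∀ a : Fin k, ∃ b, F.Adj a b) (hk : 1 ≤ k) :
    F.edgeFinset.Nonempty := by
  obtain ⟨b, hb⟩ := hF ⟨0, by omega⟩
  exact ⟨s(⟨0, by omega⟩, b), by rw [mem_edgeFinset]; exact hb⟩

/-- `ε (n/2)^k / k! ≤ ε |H_n(F)|` for `n ≥ 2k`. [folklore] -/
theorem eps_mul_pow_le_card_copyH (hF : ∀ a : Fin k, ∃ b, F.Adj a b) {ε : ℝ} (hε : 0 ≤ ε) {n : ℕ}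
    (hn : 2 * k ≤ n) : ε * ((n : ℝ) / 2) ^ k / k.factorial ≤ ε * #(copyH F n) := by
  have h1 := pow_div_le_choose (k := k) hn
  have h2 : (n.choose k : ℝ) ≤ #(copyH F n) := by exact_mod_cast choose_le_card_copyH hF n
  have := mul_le_mul_of_nonneg_left (h1.trans h2) hε
  rw [mul_div_assoc]; exact this

/-- **Qualifying ground sets are large**: if `C ⊆ E(K_n)` carries an `ε`-fraction of the copies
of `F` (`F` without isolated vertices on `k ≥ 2` vertices, `n ≥ 2k`) then `|C| ≥ γ · C(n,2)`,
`γ = gammaC k ε`, since each pair lies in `≤ k^k n^{k-2}` copies. [cite: NenadovSteger2014, Cor. 3 (proof)] -/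
theorem copy_large (hF : ∀ a : Fin k, ∃ b, F.Adj a b) (hk : 2 ≤ k) {ε : ℝ} (hε : 0 < ε) {n : ℕ}
    (hn : 2 * k ≤ n) (C : Finset (Sym2 (Fin n))) (hC : C ⊆ pairsX n)
    (hCH : ε * #(copyH F n) ≤ #(induce (copyH F n) C)) :
    gammaC k ε * #(pairsX n) ≤ #C := by
  have hk1 : 1 ≤ k := by omega
  have hkR : (0 : ℝ) < k := by exact_mod_cast hk1
  have hE := edgeFinset_nonempty_of_noIsolated hF hk1
  have h1 : (#(induce (copyH F n) C) : ℝ) ≤ #C * ((k : ℝ) ^ k * (n : ℝ) ^ (k - 2)) := by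
    exact_mod_cast card_induce_copyH_le hE hC
  have hfac : (0 : ℝ) < k.factorial := by exact_mod_cast Nat.factorial_pos k
  have h2 : ε * ((n : ℝ) / 2) ^ k / k.factorial ≤ #C * ((k : ℝ) ^ k * (n : ℝ) ^ (k - 2)) :=
    (eps_mul_pow_le_card_copyH hF hε.le hn).trans (hCH.trans h1)
  have hnk : (n : ℝ) ^ k = (n : ℝ) ^ (k - 2) * (n : ℝ) ^ 2 := by
    rw [← pow_add]; congr 1; omega
  have hn1 : (1 : ℝ) ≤ n := by
    have : 1 ≤ n := by omega
    exact_mod_cast this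
  have hn2 : (0 : ℝ) < (n : ℝ) ^ (k - 2) := by positivity
  have hX2 : (#(pairsX n) : ℝ) ≤ (n : ℝ) ^ 2 := by
    rw [card_pairsX]
    exact_mod_cast Nat.choose_le_pow n 2
  have h3 : ε * ((n : ℝ) / 2) ^ k / k.factorial =
      (ε * (n : ℝ) ^ 2 / (2 ^ k * k.factorial)) * (n : ℝ) ^ (k - 2) := by
    rw [div_pow, hnk]; field_simp
  have h4 : #C * ((k : ℝ) ^ k * (n : ℝ) ^ (k - 2)) = (#C * (k : ℝ) ^ k) * (n : ℝ) ^ (k - 2) := by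
    ring
  rw [h3, h4] at h2
  have h5 : ε * (n : ℝ) ^ 2 / (2 ^ k * k.factorial) ≤ #C * (k : ℝ) ^ k :=
    le_of_mul_le_mul_right h2 hn2
  rw [div_le_iff₀ (by positivity)] at h5
  rw [gammaC, div_mul_eq_mul_div, div_le_iff₀ (by positivity)]
  calc ε * (#(pairsX n) : ℝ) ≤ ε * (n : ℝ) ^ 2 := mul_le_mul_of_nonneg_left hX2 hε.le
    _ ≤ #C * (k : ℝ) ^ k * (2 ^ k * k.factorial) := h5
    _ = #C * (2 ^ k * k.factorial * (k : ℝ) ^ k) := by ring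

/-- Algebra for the sparsification term bound (an unconditional rational-function identity).
[folklore] -/
theorem sparse_alg1 (K P η c D1 : ℝ) {ε N kf : ℝ} (hε : ε ≠ 0) (hN : N ≠ 0) (hkf : kf ≠ 0)
    (k : ℕ) :
    12 * (K * P) * (2 * (η * c * D1) / (ε * (N / 2) ^ k / kf)) =
      (24 * K * kf * 2 ^ k * η * c) * (P * D1) / (ε * N ^ k) := by
  rw [div_pow]
  field_simp
  ring

/-- Algebra for the sparsification term bound: cancelling `n^{k-2}`. [folklore] -/
theorem sparse_alg2 (a x d e n2 : ℝ) (hx : x ≠ 0) :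
    a * (x * d) / (e * (x * n2)) = a / (e * n2) * d := by
  rw [mul_div_assoc, mul_comm x d, mul_comm x n2, ← mul_assoc e, mul_div_mul_right _ _ hx]
  ring

/-- The exponent bookkeeping `n^{k - 2 - (ℓ-1)/m} · D^{e_F - 1} = n^{k-2} · D^{e_F - ℓ}` for
`D = n^{1/m}`. [folklore] -/
theorem rpow_mul_pow_eq {n : ℕ} (hn : 0 < (n : ℝ)) {m : ℝ} (hm : m ≠ 0) {kk ℓ eF : ℕ}
    (hk : 2 ≤ kk) (hℓ1 : 1 ≤ ℓ) (hℓ : ℓ ≤ eF) :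
    (n : ℝ) ^ ((kk : ℝ) - 2 - ((ℓ : ℝ) - 1) / m) * ((n : ℝ) ^ (1 / m)) ^ (eF - 1) =
      (n : ℝ) ^ (kk - 2) * ((n : ℝ) ^ (1 / m)) ^ (eF - ℓ) := by
  rw [← Real.rpow_natCast _ (eF - 1), ← Real.rpow_natCast _ (eF - ℓ),
    ← Real.rpow_mul hn.le, ← Real.rpow_mul hn.le, ← Real.rpow_add hn,
    ← Real.rpow_natCast _ (kk - 2), ← Real.rpow_add hn]
  congr 1
  rw [Nat.cast_sub hℓ, Nat.cast_sub (hℓ1.trans hℓ), Nat.cast_one, Nat.cast_sub hk, Nat.cast_two]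
  field_simp
  ring

/-- **Homogeneous sparsification of the copy hypergraph** (the input `IterHyp.sparse`): for a
qualifying ground set `C`, a subfamily `H' ⊆ H_n(F)[C]` of size `⌈η |C| D^{e_F-1}⌉` with
`deg_{H'}(u) ≤ D^{e_F - |u|}` for all `1 ≤ |u| ≤ e_F - 1`, `D = n^{1/m₂(F)}`, obtained from
`exists_subfamily_hdeg_lt`: the co-degree bound `hdeg_copyH_le_rpow` makes every term
`≤ 4^{-D}`, and there are `≤ e_F (C(n,2)+1)^{e_F}` terms. [cite: BaloghMorrisSamotij2019, §3 (the condition on Δ_ℓ)] -/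
theorem copy_sparse (hF : ∀ a : Fin k, ∃ b, F.Adj a b) (hk : 3 ≤ k) (hm : 1 < m2Density F)
    {ε : ℝ} (hε : 0 < ε) {n : ℕ} (L0 : 2 * k ≤ n)
    (L1 : 1 ≤ etaC k #F.edgeFinset ε * (gammaC k ε * (n.choose 2 : ℝ)) *
      ((n : ℝ) ^ (1 / (m2Density F : ℝ))) ^ (#F.edgeFinset - 1))
    (L4 : etaC k #F.edgeFinset ε * (n.choose 2 : ℝ) *
      ((n : ℝ) ^ (1 / (m2Density F : ℝ))) ^ (#F.edgeFinset - 1) + 1 ≤ ε * (n.choose k : ℝ))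
    (L5 : (#F.edgeFinset : ℝ) * ((n.choose 2 : ℝ) + 1) ^ #F.edgeFinset *
      (4⁻¹ : ℝ) ^ ((n : ℝ) ^ (1 / (m2Density F : ℝ))) < 1)
    (C : Finset (Sym2 (Fin n))) (hC : C ⊆ pairsX n)
    (hCH : ε * #(copyH F n) ≤ #(induce (copyH F n) C)) :
    ∃ H' ⊆ induce (copyH F n) C, IsBounded H' #F.edgeFinset ((n : ℝ) ^ (1 / (m2Density F : ℝ))) ∧
      etaC k #F.edgeFinset ε * #C * ((n : ℝ) ^ (1 / (m2Density F : ℝ))) ^ (#F.edgeFinset - 1) ≤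
        #H' := by
  classical
  set eF := #F.edgeFinset with heF
  set m : ℝ := (m2Density F : ℝ) with hmdef
  set D : ℝ := (n : ℝ) ^ (1 / m) with hDdef
  set η : ℝ := etaC k eF ε with hηdef
  set γ : ℝ := gammaC k ε with hγdef
  set H := copyH F n with hHdef
  have hm0 : 0 < m2Density F := lt_trans zero_lt_one hm
  have hmpos : (0 : ℝ) < m := by rw [hmdef]; exact_mod_cast hm0
  have hk1 : 1 ≤ k := by omega
  have hkR : (0 : ℝ) < k := by exact_mod_cast hk1
  have hn1 : 1 ≤ n := by omega
  have hnR : (1 : ℝ) ≤ n := by exact_mod_cast hn1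
  have hnpos : (0 : ℝ) < n := by linarith
  have hD1 : 1 ≤ D := by rw [hDdef]; exact Real.one_le_rpow hnR (by positivity)
  have hDpos : 0 < D := by linarith
  have hηpos : 0 < η := etaC_pos hk1 eF hε
  have hE : F.edgeFinset.Nonempty := edgeFinset_nonempty_of_noIsolated hF hk1
  have heF1 : 1 ≤ eF := by rw [heF]; exact card_pos.2 hE
  have hHlow := eps_mul_pow_le_card_copyH hF hε.le L0
  have hCcard : (#C : ℝ) ≤ n.choose 2 := by
    rw [← card_pairsX n]; exact_mod_cast card_le_card hC
  have hγC : γ * #(pairsX n) ≤ #C := copy_large hF (by omega) hε L0 C hC hCH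
  rw [card_pairsX] at hγC
  -- the size of the subfamily
  set msize : ℕ := ⌈η * #C * D ^ (eF - 1)⌉₊ with hmsize
  have hmsize_ge : η * #C * D ^ (eF - 1) ≤ msize := Nat.le_ceil _
  have hprod_nonneg : 0 ≤ η * #C * D ^ (eF - 1) := by positivity
  have hmsize_le : (msize : ℝ) ≤ 2 * (η * #C * D ^ (eF - 1)) := by
    have h1 := Nat.ceil_lt_add_one hprod_nonneg
    have hbase : 1 ≤ η * #C * D ^ (eF - 1) := by
      refine L1.trans ?_
      have : η * (γ * (n.choose 2 : ℝ)) ≤ η * #C := mul_le_mul_of_nonneg_left hγC hηpos.le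
      exact mul_le_mul_of_nonneg_right this (by positivity)
    rw [← hmsize] at h1
    linarith
  have hH₀ : ε * #H ≤ #(induce H C) := hCH
  have hmsize_le_card : msize ≤ #(induce H C) := by
    have h0 := Nat.ceil_lt_add_one hprod_nonneg
    rw [← hmsize] at h0
    have h2 : η * #C * D ^ (eF - 1) ≤ η * (n.choose 2 : ℝ) * D ^ (eF - 1) := by
      apply mul_le_mul_of_nonneg_right _ (by positivity)
      exact mul_le_mul_of_nonneg_left hCcard hηpos.le
    have h3 : ε * (n.choose k : ℝ) ≤ ε * #H :=
      mul_le_mul_of_nonneg_left (by exact_mod_cast choose_le_card_copyH hF n) hε.le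
    have : (msize : ℝ) ≤ #(induce H C) := by linarith
    exact_mod_cast this
  -- the test family and thresholds
  set B := C.powerset.filter fun u => 1 ≤ #u ∧ #u + 1 ≤ eF with hB
  set t : Finset (Sym2 (Fin n)) → ℕ := fun u => ⌊D ^ (eF - #u)⌋₊ + 1 with ht
  have hq0 : (0 : ℝ) ≤ (msize : ℝ) / #(induce H C) := by positivity
  have hHCpos : (0 : ℝ) < #(induce H C) := lt_of_lt_of_le (by positivity) (hHlow.trans hH₀)
  have hfac : (0 : ℝ) < k.factorial := by exact_mod_cast Nat.factorial_pos k
  have hηle' : η * (12 * (k : ℝ) ^ k * k.factorial * 2 ^ k) ≤ ε :=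
    (le_div_iff₀ (by positivity)).1 (etaC_le_div k eF ε)
  have hC2 : (#C : ℝ) ≤ (n : ℝ) ^ 2 / 2 := by
    refine hCcard.trans ?_
    rw [Nat.cast_choose_two]
    nlinarith
  -- each term is `≤ 4^{-D}`
  have hterm : ∀ u ∈ B, ((hdeg (induce H C) u).choose (t u) : ℝ) *
      ((msize : ℝ) / #(induce H C)) ^ (t u) ≤ (4⁻¹ : ℝ) ^ D := by
    intro u hu
    rw [hB, mem_filter, mem_powerset] at hu
    obtain ⟨huC, hu1, hueF⟩ := hu
    set P : ℝ := (n : ℝ) ^ ((k : ℝ) - 2 - ((#u : ℝ) - 1) / m) with hP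
    have hdegu : (hdeg (induce H C) u : ℝ) ≤ (k : ℝ) ^ k * P := by
      calc (hdeg (induce H C) u : ℝ) ≤ hdeg H u := by
            exact_mod_cast hdeg_mono (induce_subset H C) u
        _ ≤ _ := hdeg_copyH_le_rpow hn1 hm0 (huC.trans hC) hu1
    have hq : (msize : ℝ) / #(induce H C) ≤
        2 * (η * #C * D ^ (eF - 1)) / (ε * ((n : ℝ) / 2) ^ k / k.factorial) := by
      rw [div_le_div_iff₀ hHCpos (by positivity)]
      exact mul_le_mul hmsize_le (hHlow.trans hH₀) (by positivity) (by positivity)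
    have hexp : P * D ^ (eF - 1) = (n : ℝ) ^ (k - 2) * D ^ (eF - #u) :=
      rpow_mul_pow_eq hnpos hmpos.ne' (by omega) hu1 (by omega)
    have hD2pos : 0 < D ^ (eF - #u) := by positivity
    have hn2 : (n : ℝ) ^ (k - 2) ≠ 0 := by positivity
    have hkey : 12 * (hdeg (induce H C) u : ℝ) * ((msize : ℝ) / #(induce H C)) ≤ t u := by
      have htu : D ^ (eF - #u) < t u := by rw [ht]; push_cast; exact Nat.lt_floor_add_one _
      refine le_trans ?_ htu.le
      have hstep3 : (24 * (k : ℝ) ^ k * k.factorial * 2 ^ k * η * #C) / (ε * (n : ℝ) ^ 2) ≤ 1 := by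
        rw [div_le_one (by positivity)]
        calc 24 * (k : ℝ) ^ k * k.factorial * 2 ^ k * η * #C
            ≤ 24 * (k : ℝ) ^ k * k.factorial * 2 ^ k * η * ((n : ℝ) ^ 2 / 2) :=
              mul_le_mul_of_nonneg_left hC2 (by positivity)
          _ = (η * (12 * (k : ℝ) ^ k * k.factorial * 2 ^ k)) * (n : ℝ) ^ 2 := by ring
          _ ≤ ε * (n : ℝ) ^ 2 := mul_le_mul_of_nonneg_right hηle' (by positivity)
      have hnk : (n : ℝ) ^ k = (n : ℝ) ^ (k - 2) * (n : ℝ) ^ 2 := by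
        rw [← pow_add]; congr 1; omega
      calc 12 * (hdeg (induce H C) u : ℝ) * ((msize : ℝ) / #(induce H C))
          ≤ 12 * ((k : ℝ) ^ k * P) *
              (2 * (η * #C * D ^ (eF - 1)) / (ε * ((n : ℝ) / 2) ^ k / k.factorial)) := by
            apply mul_le_mul (mul_le_mul_of_nonneg_left hdegu (by norm_num)) hq hq0
            positivity
        _ = (24 * (k : ℝ) ^ k * k.factorial * 2 ^ k * η * #C) * (P * D ^ (eF - 1)) /
              (ε * (n : ℝ) ^ k) := sparse_alg1 _ _ _ _ _ hε.ne' hnpos.ne' hfac.ne' k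
        _ = ((24 * (k : ℝ) ^ k * k.factorial * 2 ^ k * η * #C) / (ε * (n : ℝ) ^ 2)) *
              D ^ (eF - #u) := by
            rw [hexp, hnk]
            exact sparse_alg2 _ _ _ _ _ hn2
        _ ≤ 1 * D ^ (eF - #u) := mul_le_mul_of_nonneg_right hstep3 hD2pos.le
        _ = D ^ (eF - #u) := one_mul _
    have h4 := choose_mul_pow_le_quarter_pow hq0 hkey
    refine h4.trans ?_
    have htD : D ≤ (t u : ℝ) := by
      have h1 : D ≤ D ^ (eF - #u) := by
        calc D = D ^ 1 := (pow_one D).symm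
          _ ≤ D ^ (eF - #u) := pow_le_pow_right₀ hD1 (by omega)
      have h2 : D ^ (eF - #u) < t u := by rw [ht]; push_cast; exact Nat.lt_floor_add_one _
      linarith
    rw [← Real.rpow_natCast]
    exact Real.rpow_le_rpow_of_exponent_ge (by norm_num) (by norm_num) htD
  -- the number of terms
  have hBcard : (#B : ℝ) ≤ (eF : ℝ) * ((n.choose 2 : ℝ) + 1) ^ eF := by
    have hsub : B ⊆ (Finset.range eF).biUnion fun ℓ => C.powersetCard ℓ := by
      intro u hu
      rw [hB, mem_filter, mem_powerset] at hu
      rw [mem_biUnion]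
      exact ⟨#u, Finset.mem_range.2 (by omega), mem_powersetCard.2 ⟨hu.1, rfl⟩⟩
    calc (#B : ℝ) ≤ ∑ ℓ ∈ Finset.range eF, (#(C.powersetCard ℓ) : ℝ) := by
          exact_mod_cast (card_le_card hsub).trans card_biUnion_le
      _ ≤ ∑ _ℓ ∈ Finset.range eF, ((n.choose 2 : ℝ) + 1) ^ eF := by
          refine sum_le_sum fun ℓ hℓ => ?_
          rw [Finset.mem_range] at hℓ
          rw [card_powersetCard]
          calc ((#C).choose ℓ : ℝ) ≤ (#C : ℝ) ^ ℓ := by exact_mod_cast Nat.choose_le_pow _ _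
            _ ≤ ((n.choose 2 : ℝ) + 1) ^ ℓ := pow_le_pow_left₀ (by positivity) (by linarith) ℓ
            _ ≤ ((n.choose 2 : ℝ) + 1) ^ eF :=
                pow_le_pow_right₀ (by linarith [Nat.cast_nonneg (α := ℝ) (n.choose 2)]) hℓ.le
      _ = (eF : ℝ) * ((n.choose 2 : ℝ) + 1) ^ eF := by
          rw [sum_const, Finset.card_range, nsmul_eq_mul]
  have hsum : ∑ u ∈ B, ((hdeg (induce H C) u).choose (t u) : ℝ) *
      ((msize : ℝ) / #(induce H C)) ^ (t u) < 1 := by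
    calc _ ≤ ∑ _u ∈ B, (4⁻¹ : ℝ) ^ D := sum_le_sum hterm
      _ = #B * (4⁻¹ : ℝ) ^ D := by rw [sum_const, nsmul_eq_mul]
      _ ≤ (eF : ℝ) * ((n.choose 2 : ℝ) + 1) ^ eF * (4⁻¹ : ℝ) ^ D :=
          mul_le_mul_of_nonneg_right hBcard (by positivity)
      _ < 1 := L5
  obtain ⟨H', hH'sub, hH'card, hH'deg⟩ :=
    exists_subfamily_hdeg_lt (induce H C) hmsize_le_card B id t hsum
  refine ⟨H', hH'sub, ?_, ?_⟩
  · intro u hu1 hueF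
    by_cases huC : u ⊆ C
    · have huB : u ∈ B := by
        rw [hB, mem_filter, mem_powerset]; exact ⟨huC, hu1, hueF⟩
      have h := hH'deg u huB
      have h' : hdeg H' u ≤ ⌊D ^ (eF - #u)⌋₊ := Nat.lt_add_one_iff.1 h
      calc (hdeg H' u : ℝ) ≤ ⌊D ^ (eF - #u)⌋₊ := by exact_mod_cast h'
        _ ≤ D ^ (eF - #u) := Nat.floor_le (by positivity)
    · have h0 : hdeg H' u = 0 := by
        rw [hdeg, card_eq_zero, filter_eq_empty_iff]
        intro e he hue
        have := (mem_induce.1 (hH'sub he)).2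
        exact huC (hue.trans this)
      rw [h0, Nat.cast_zero]; positivity
  · rw [hH'card]; exact hmsize_ge

/-- **Nenadov–Steger, Theorem 5 (containers for `F`-free graphs), via BDTT + sparsification +
iteration, at a fixed large `n`.** Let `F` be a graph on `Fin k`, `k ≥ 3`, without isolated
vertices and with `m₂(F) > 1`, let `ε > 0`, `η = etaC`, `γ = gammaC`, `θ = η^{3^{e_F-1}}`,
`D = n^{1/m₂(F)}`, and let `R` satisfy `(1 - θ/2)^R < γ`. If `n` is large in the explicit sense
of the hypotheses `L0`–`L5`, then there are maps `Print` (an `R × (e_F - 1)` array of fingerprints)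
and `Cont` such that every `F`-free edge set `I ⊆ E(K_n)` (independent set of the copy
hypergraph) has fingerprints `⊆ I` of size `≤ C(n,2)/D` (`≤ n^{2 - 1/m₂(F)}`), and a container
`Cont (Print I) ⊇ I` inside `E(K_n)` carrying fewer than `ε |H_n(F)|` copies of `F`.
[cite: NenadovSteger2014, Thm. 5 (p. 3)] -/
theorem ns_theorem5 (hF : ∀ a : Fin k, ∃ b, F.Adj a b) (hk : 3 ≤ k) (hm : 1 < m2Density F)
    {ε : ℝ} (hε : 0 < ε) {n : ℕ} (R : ℕ)
    (hR : (1 - etaC k #F.edgeFinset ε ^ (3 ^ (#F.edgeFinset - 1)) / 2) ^ R < gammaC k ε)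
    (L0 : 2 * k ≤ n)
    (L1 : 1 ≤ etaC k #F.edgeFinset ε * (gammaC k ε * (n.choose 2 : ℝ)) *
      ((n : ℝ) ^ (1 / (m2Density F : ℝ))) ^ (#F.edgeFinset - 1))
    (L2 : 2 ^ (#F.edgeFinset - 1) * (n : ℝ) ^ (1 / (m2Density F : ℝ)) ≤
      gammaC k ε * (n.choose 2 : ℝ))
    (L3 : 2 * ((#F.edgeFinset : ℝ) - 1) ≤ etaC k #F.edgeFinset ε ^ (3 ^ (#F.edgeFinset - 1)) *
      gammaC k ε * (n : ℝ) ^ (1 / (m2Density F : ℝ)))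
    (L4 : etaC k #F.edgeFinset ε * (n.choose 2 : ℝ) *
      ((n : ℝ) ^ (1 / (m2Density F : ℝ))) ^ (#F.edgeFinset - 1) + 1 ≤ ε * (n.choose k : ℝ))
    (L5 : (#F.edgeFinset : ℝ) * ((n.choose 2 : ℝ) + 1) ^ #F.edgeFinset *
      (4⁻¹ : ℝ) ^ ((n : ℝ) ^ (1 / (m2Density F : ℝ))) < 1) :
    ∃ (Print : Finset (Sym2 (Fin n)) → (Fin R → Fin (#F.edgeFinset - 1) → Finset (Sym2 (Fin n))))
      (Cont : (Fin R → Fin (#F.edgeFinset - 1) → Finset (Sym2 (Fin n))) → Finset (Sym2 (Fin n))),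
      ∀ I ⊆ pairsX n, IsIndep (copyH F n) I →
        (∀ ρ i, Print I ρ i ⊆ I ∧
          (#(Print I ρ i) : ℝ) ≤ (n.choose 2 : ℝ) / (n : ℝ) ^ (1 / (m2Density F : ℝ))) ∧
        Cont (Print I) ⊆ pairsX n ∧ I ⊆ Cont (Print I) ∧
        (#(induce (copyH F n) (Cont (Print I))) : ℝ) < ε * #(copyH F n) := by
  have hm0 : 0 < m2Density F := lt_trans zero_lt_one hm
  have hk1 : 1 ≤ k := by omega
  have hn1 : 1 ≤ n := by omega
  have hnR : (1 : ℝ) ≤ n := by exact_mod_cast hn1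
  have hD1 : 1 ≤ (n : ℝ) ^ (1 / (m2Density F : ℝ)) :=
    Real.one_le_rpow hnR (by positivity)
  have hDpos : 0 < (n : ℝ) ^ (1 / (m2Density F : ℝ)) := by linarith
  have hE : F.edgeFinset.Nonempty := edgeFinset_nonempty_of_noIsolated hF hk1
  have heF1 : 1 ≤ #F.edgeFinset := card_pos.2 hE
  have S : IterHyp (pairsX n) (copyH F n) #F.edgeFinset ((n : ℝ) ^ (1 / (m2Density F : ℝ)))
      (etaC k #F.edgeFinset ε) ε (gammaC k ε) :=
    { hk := heF1
      hH := copyH_subset_powersetCard n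
      hD := hDpos
      hη := etaC_pos hk1 _ hε
      hη2 := etaC_le_pow k _ ε
      hγ := gammaC_pos hk1 hε
      hDX := by rw [card_pairsX]; exact L2
      hshrink := by
        have hX0 : (0 : ℝ) ≤ #(pairsX n) := Nat.cast_nonneg _
        rw [mul_div_assoc', div_le_iff₀ hDpos]
        have := mul_le_mul_of_nonneg_right L3 hX0
        nlinarith
      large := fun C hC hCH => copy_large hF (by omega) hε L0 C hC hCH
      sparse := fun C hC hCH => copy_sparse hF hk hm hε L0 L1 L4 L5 C hC hCH }
  obtain ⟨Print, Cont, hPC⟩ := iterated_containers S R hR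
  refine ⟨Print, Cont, fun I hI hind => ?_⟩
  obtain ⟨h1, h2, h3, h4⟩ := hPC I hI hind
  refine ⟨fun ρ i => ⟨(h1 ρ i).1, ?_⟩, h2, h3, h4⟩
  have := (h1 ρ i).2
  rwa [card_pairsX] at this

end CopyContainers

end Literature.Combinatorics.SimpleGraph
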